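import Literature.Claims.NS.Li2013b
import Literature.Analysis.ODE.SuperlinearPowerLawLocalBound
import Literature.Analysis.FunctionSpaces.TorusFractionalSobolevEmbedding
import Summits.NavierStokesRegularity.NavierStokesRegularity.Theorems.SoloRefuteLi2013b
import Literature.Analysis.FluidPDE.TorusNSSmallDataGlobal
import HarnessLib

/-!
# Solo salvage for claim C24 `Li2013b` (cell `ns-claims`, D-0090): Step 2 — the Poincaré chain (40)
# p. 8 — and Step 3 — the scalar comparison (41) ⇒ (42) ⇒ (43) p. 8 — are TRUE (kernel)

Text of record: Jun-De Li, arXiv 1310.8031 v1 (2013; v2 = withdrawal), skeleton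
`Literature.Claims.NS.Li2013b` (typist-9, p471752; rev p500962). ADJUDICATED #40: locator = hypothesis (38)
`DataClass38` p. 7, class vacuous (`…Theorems.Li2013b.dataClass38_eq_zero`, p478050). The Proposal-5 proof
pp. 7–8 is typed as Steps 1–4; Step 4 is kernel (`step4_horizonGrows_holds`, p500962). This file discharges
**Step 3** `Step3_Comparison42`: a continuous `y ≥ 0` on `[0,T]` with right derivatives
`y' ≤ C·y·y^{2r/(2r−1)}` on `[0,T)` and `y(0) ≤ y₀` stays bounded on `[0,T]` whenever
`T·2rC·y₀^{2r/(2r−1)} < 2r − 1` — the printed Grönwall-type step, (41)–(43) p. 8.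

It is the instance `p = 1 + 2r/(2r−1) = (4r−1)/(2r−1)` of the tree's general sharp bound
`Literature.Analysis.ODE.le_profile_of_deriv_le_rpow` (`y' ≤ C y^p`, `p > 1`, horizon
`(p−1)·C·y(0)^{p−1}·b < 1` ⇒ `y ≤` the sharp majorant; `SuperlinearPowerLawLocalBound.lean`, p493266): the
printed horizon condition is exactly `(p−1)·C·y₀^{p−1}·T < 1` after division by `2r − 1 > 0`, and the
majorant is monotone in `t`, so its value at `t = T` bounds `y` on `[0,T]`.

* `step3_comparison42_holds : Literature.Claims.NS.Li2013b.Step3_Comparison42`.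
* `step2_poincare40_holds : Literature.Claims.NS.Li2013b.Step2_Poincare40` — (40) p. 8 via (9) p. 3: for a
  smooth zero-average divergence-free field on the unit torus and `r ≥ 1`, `‖v‖_r² < ∞` and
  `λ₁^{r−1}‖v‖₁² ≤ ‖v‖_r²` (`λ₁ = 4π²`): termwise `|k|² ≤ |k|^{2r}` on the integer lattice (`|k| ≥ 1` for
  `k ≠ 0`) and `(4π²)^{r−1}(2π)² = (2π)^{2r}`; finiteness from the rapid decay of the Fourier coefficients of
  a smooth field (tree `Torus.IsSmooth.summable_freqNormSq_rpow_mul_norm_sq`,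
  `Torus.eHomSobolevSeminorm_complexify_sq_eq_ofReal_tsum`).

* `step5_proposal5_holds` (rev 2) : `Literature.Claims.NS.Li2013b.Step5_Proposal5` — Proposal 5 p. 7 AS
  PRINTED is true, vacuously: (38) forces `u₀ = 0` (`…Theorems.Li2013b.dataClass38_eq_zero`) and the only
  classical mean-zero solution from the zero datum is the rest state (uniqueness of strong solutions, tree
  `Torus.IsClassicalNSSolutionOn.eq_zero_of_gradNormSq_eq_zero_of_le`).

With `step4_horizonGrows_holds` (p500962) the whole printed proof of Proposal 5 (Steps 2–4) is kernel except
Lemma 4 in its r-uniform typing (Step 1, off-locator); with rev 2 every typed step but Step 1 is kernel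
(Steps 2–5 here and p500962; Step 6 and the claimed theorem `…Theorems.Li2013b.step6_Lemma6_holds` /
`claimedTheorem_holds`, p478050). TRUE mathematics only (D-0026 «kernel-certified
earlier steps»); nothing here bears on the vacuity verdict.
Salvage seat ns-claims-salvage-p5 g3 (backup chain for the C24 lane). Solo lane (no item).

WHAT THIS IS NOT: not a claim about NS regularity or blow-up; not a claim about any author beyond the
typed locator.
-/

-- lint debt (one line): the Theorems namespace repeats the summit name by the D-0017 layout
-- (single-conjunct summit), as in every sibling Solo file.
set_option linter.dupNamespace false

noncomputable section

open Set Real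

namespace Summit.NavierStokesRegularity.NavierStokesRegularity.Theorems.Li2013bSalvage

open Literature.Claims.NS.Li2013b Literature.Analysis.ODE
open Literature.Analysis.FunctionSpaces Literature.Analysis.FunctionSpaces.Torus
open Summit.NavierStokesRegularity.NavierStokesRegularity.Theorems.Li2013b

/-- `expo r = 2r/(2r−1)` is positive for `r ≥ 1`. [cite: LiJunDe2013NSPeriodic, eq. (39)–(42) p. 8] -/
theorem expo_pos {r : ℕ} (hr : 1 ≤ r) : 0 < expo r := by
  unfold expo
  have hr' : (1 : ℝ) ≤ r := by exact_mod_cast hr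
  apply div_pos <;> linarith

/-- `expo r · (2r − 1) = 2r` for `r ≥ 1`. [cite: LiJunDe2013NSPeriodic, eq. (39)–(42) p. 8] -/
theorem expo_mul_sub {r : ℕ} (hr : 1 ≤ r) : expo r * (2 * r - 1) = 2 * r := by
  unfold expo
  have hr' : (1 : ℝ) ≤ r := by exact_mod_cast hr
  have hne : (2 * (r : ℝ) - 1) ≠ 0 := by linarith
  rw [div_mul_cancel₀ _ hne]

/-- **Step 3 ((41) ⇒ (42) ⇒ (43), p. 8) holds** — «Applying the Gronwall type of inequality»: for
`r ≥ 1`, `C > 0`, `y₀ ≥ 0`, a continuous non-negative `y` on `[0,T]` with right derivatives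
`y' ≤ C·y·y^{2r/(2r−1)}` on `[0,T)` and `y(0) ≤ y₀` is bounded on `[0,T]` provided
`T·2rC·y₀^{2r/(2r−1)} < 2r − 1`. Proof: instance `p = 1 + 2r/(2r−1)` of
`Literature.Analysis.ODE.le_profile_of_deriv_le_rpow` (sharp majorant
`y(0)(1 − (p−1)C y(0)^{p−1} t)^{−1/(p−1)}`, evaluated at `t = T`).
[cite: LiJunDe2013NSPeriodic, eq. (41)–(43) p. 8] -/
theorem step3_comparison42_holds : Step3_Comparison42 := by
  intro y T C y₀ r hr hC hy₀ hcont hnn hy0 hder hhor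
  by_cases hT : 0 ≤ T
  swap
  · exact ⟨0, fun t ht => absurd (ht.1.trans ht.2) hT⟩
  -- abbreviations
  set e : ℝ := expo r with he_def
  have he : 0 < e := expo_pos hr
  have hr' : (1 : ℝ) ≤ r := by exact_mod_cast hr
  have h2r1 : (0 : ℝ) < 2 * r - 1 := by linarith
  have hp : (1 : ℝ) < 1 + e := by linarith
  have hy00 : 0 ≤ y 0 := hnn 0 ⟨le_rfl, hT⟩
  -- a derivative selector on `[0,T)`
  classical
  let y' : ℝ → ℝ := fun t => if h : t ∈ Ico 0 T then Classical.choose (hder t h) else 0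
  have hy'1 : ∀ t ∈ Ico 0 T, HasDerivWithinAt y (y' t) (Ici t) t := by
    intro t ht
    have := (Classical.choose_spec (hder t ht)).1
    simp only [y', dif_pos ht]
    exact this
  have hy'2 : ∀ t ∈ Ico 0 T, y' t ≤ C * y t ^ (1 + e) := by
    intro t ht
    have h := (Classical.choose_spec (hder t ht)).2
    simp only [y', dif_pos ht]
    have hyt : 0 ≤ y t := hnn t (Ico_subset_Icc_self ht)
    rw [Real.rpow_add' hyt (by linarith), Real.rpow_one, ← mul_assoc]
    exact h
  -- the horizon condition in the tree's form
  have hhor' : (1 + e - 1) * C * y 0 ^ (1 + e - 1) * T < 1 := by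
    have h1 : (1 + e - 1) = e := by ring
    rw [h1]
    have hpow : y 0 ^ e ≤ y₀ ^ e := Real.rpow_le_rpow hy00 hy0 he.le
    have h2 : e * C * y 0 ^ e * T ≤ e * C * y₀ ^ e * T := by
      have : 0 ≤ e * C := by positivity
      have : e * C * y 0 ^ e ≤ e * C * y₀ ^ e := mul_le_mul_of_nonneg_left hpow this
      exact mul_le_mul_of_nonneg_right this hT
    have h3 : e * C * y₀ ^ e * T < 1 := by
      -- `T·(2rC y₀^e) < 2r − 1` divided by `2r − 1 > 0`, using `e(2r−1) = 2r`
      have hmul := expo_mul_sub hr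
      rw [← he_def] at hmul
      have : e * C * y₀ ^ e * T * (2 * r - 1) = T * (2 * r * C * y₀ ^ e) := by
        calc e * C * y₀ ^ e * T * (2 * r - 1) = (e * (2 * r - 1)) * C * y₀ ^ e * T := by ring
          _ = T * (2 * r * C * y₀ ^ e) := by rw [hmul]; ring
      have hlt : e * C * y₀ ^ e * T * (2 * r - 1) < 1 * (2 * r - 1) := by
        rw [this, one_mul]; exact hhor
      exact lt_of_mul_lt_mul_right hlt h2r1.le
    exact h2.trans_lt h3
  have hprof := le_profile_of_deriv_le_rpow (y := y) (y' := y') hp hC.le hcont hy'1 hnn hy'2 hhor'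
  -- uniform bound: the majorant is largest at `t = T`
  set k : ℝ := (1 + e - 1) * C * y 0 ^ (1 + e - 1) with hk
  have hk0 : 0 ≤ k := by
    rw [hk]
    have : (1 + e - 1) = e := by ring
    rw [this]
    exact mul_nonneg (by positivity) (Real.rpow_nonneg hy00 _)
  have hkT : k * T < 1 := hhor'
  refine ⟨y 0 * (1 - k * T) ^ (-(1 / (1 + e - 1))), fun t ht => ?_⟩
  have hq : -(1 / (1 + e - 1)) ≤ 0 := by
    have : (1 + e - 1) = e := by ring
    rw [this, neg_nonpos]
    positivity
  have hbt : 0 < 1 - k * T := by linarith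
  have hmono : (1 - k * t) ^ (-(1 / (1 + e - 1))) ≤ (1 - k * T) ^ (-(1 / (1 + e - 1))) := by
    apply Real.rpow_le_rpow_of_nonpos hbt _ hq
    have : k * t ≤ k * T := mul_le_mul_of_nonneg_left ht.2 hk0
    linarith
  calc y t ≤ y 0 * (1 - k * t) ^ (-(1 / (1 + e - 1))) := hprof t ht
    _ ≤ y 0 * (1 - k * T) ^ (-(1 / (1 + e - 1))) := mul_le_mul_of_nonneg_left hmono hy00

/-! ### Step 2: the Poincaré chain (40) -/

/-- Termwise comparison on the integer lattice: `|k|² · a ≤ |k|^{2r} · a` for `a ≥ 0`, `r ≥ 1`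
(`|k|² ≥ 1` for `k ≠ 0`; both sides vanish at `k = 0`). [cite: LiJunDe2013NSPeriodic, eq. (9) p. 3] -/
theorem freqNormSq_mul_le_rpow_mul {d : Type*} [Fintype d] (k : d → ℤ) {r : ℕ} (hr : 1 ≤ r)
    {a : ℝ} (ha : 0 ≤ a) :
    freqNormSq k ^ (1 : ℝ) * a ≤ freqNormSq k ^ (r : ℝ) * a := by
  refine mul_le_mul_of_nonneg_right ?_ ha
  by_cases hk : k = 0
  · subst hk
    have hr0 : (r : ℝ) ≠ 0 := by exact_mod_cast (show r ≠ 0 by omega)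
    rw [freqNormSq_zero, Real.zero_rpow one_ne_zero, Real.zero_rpow hr0]
  · rw [Real.rpow_one]
    exact Real.self_le_rpow_of_one_le (one_le_freqNormSq_of_ne_zero hk) (by exact_mod_cast hr)

/-- **Step 2 ((40) p. 8 via (9) p. 3) holds**: for a smooth zero-average divergence-free `v` on the unit
torus and `r ≥ 1`, `‖v‖_r² < ∞` and `λ₁^{r−1}‖v‖₁² ≤ ‖v‖_r²` with `λ₁ = 4π²` — the Poincaré chain
`‖u‖²_m ≤ λ₁^{−1}‖u‖²_{m+1}` telescoped. [cite: LiJunDe2013NSPeriodic, eq. (9) p. 3; (40) p. 8] -/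
theorem step2_poincare40_holds : Step2_Poincare40 := by
  intro v hv r hr
  obtain ⟨hsm, -, -⟩ := hv
  have hr0 : (0 : ℝ) < r := by exact_mod_cast (show 0 < r by omega)
  set a : (Fin 3 → ℤ) → ℝ := fun k => ‖UnitAddTorus.mFourierCoeff (EuclideanSpace.complexify ∘ v) k‖ ^ 2
    with ha
  have ha0 : ∀ k, 0 ≤ a k := fun k => sq_nonneg _
  have hSr : Summable fun k : Fin 3 → ℤ => freqNormSq k ^ (r : ℝ) * a k :=
    hsm.summable_freqNormSq_rpow_mul_norm_sq hr0.le
  have hS1 : Summable fun k : Fin 3 → ℤ => freqNormSq k ^ (1 : ℝ) * a k :=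
    hsm.summable_freqNormSq_rpow_mul_norm_sq zero_le_one
  have hEr : eHomSobolevSeminorm (r : ℝ) (EuclideanSpace.complexify ∘ v) ^ 2 =
      ENNReal.ofReal (∑' k, freqNormSq k ^ (r : ℝ) * a k) :=
    eHomSobolevSeminorm_complexify_sq_eq_ofReal_tsum hr0 hSr
  have hE1 : eHomSobolevSeminorm (1 : ℝ) (EuclideanSpace.complexify ∘ v) ^ 2 =
      ENNReal.ofReal (∑' k, freqNormSq k ^ (1 : ℝ) * a k) :=
    eHomSobolevSeminorm_complexify_sq_eq_ofReal_tsum one_pos hS1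
  have hnr : normSq r v =
      ENNReal.ofReal ((2 * π) ^ (2 * r)) * ENNReal.ofReal (∑' k, freqNormSq k ^ (r : ℝ) * a k) := by
    unfold normSq; rw [hEr]
  have hn1 : normSq 1 v =
      ENNReal.ofReal ((2 * π) ^ (2 * 1)) * ENNReal.ofReal (∑' k, freqNormSq k ^ (1 : ℝ) * a k) := by
    unfold normSq; rw [Nat.cast_one, hE1]
  have hsum0r : 0 ≤ ∑' k, freqNormSq k ^ (r : ℝ) * a k :=
    tsum_nonneg fun k => mul_nonneg (Real.rpow_nonneg (freqNormSq_nonneg k) _) (ha0 k)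
  have hsum01 : 0 ≤ ∑' k, freqNormSq k ^ (1 : ℝ) * a k :=
    tsum_nonneg fun k => mul_nonneg (Real.rpow_nonneg (freqNormSq_nonneg k) _) (ha0 k)
  refine ⟨?_, ?_⟩
  · rw [hnr]; exact ENNReal.mul_lt_top ENNReal.ofReal_lt_top ENNReal.ofReal_lt_top
  · have h2r : (0 : ℝ) ≤ (2 * π) ^ (2 * r) := by positivity
    have h21 : (0 : ℝ) ≤ (2 * π) ^ (2 * 1) := by positivity
    rw [hnr, hn1, ENNReal.toReal_mul, ENNReal.toReal_mul, ENNReal.toReal_ofReal h2r,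
      ENNReal.toReal_ofReal hsum0r, ENNReal.toReal_ofReal h21, ENNReal.toReal_ofReal hsum01]
    have hS : ∑' k, freqNormSq k ^ (1 : ℝ) * a k ≤ ∑' k, freqNormSq k ^ (r : ℝ) * a k :=
      Summable.tsum_le_tsum (fun k => freqNormSq_mul_le_rpow_mul k hr (ha0 k)) hS1 hSr
    have hconst : lam1 ^ (r - 1) * (2 * π) ^ (2 * 1) = (2 * π) ^ (2 * r) := by
      unfold lam1
      have h4 : (4 * π ^ 2 : ℝ) = (2 * π) ^ 2 := by ring
      rw [h4, ← pow_mul, ← pow_add]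
      congr 1
      omega
    calc lam1 ^ (r - 1) * ((2 * π) ^ (2 * 1) * ∑' k, freqNormSq k ^ (1 : ℝ) * a k)
        = (lam1 ^ (r - 1) * (2 * π) ^ (2 * 1)) * ∑' k, freqNormSq k ^ (1 : ℝ) * a k := by ring
      _ = (2 * π) ^ (2 * r) * ∑' k, freqNormSq k ^ (1 : ℝ) * a k := by rw [hconst]
      _ ≤ (2 * π) ^ (2 * r) * ∑' k, freqNormSq k ^ (r : ℝ) * a k :=
          mul_le_mul_of_nonneg_left hS (by positivity)

/-! ### Step 5: Proposal 5 is true — on its data class, which is `{0}` -/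

/-- `‖∇0‖₂² = 0` on the torus. [folklore] -/
theorem gradNormSq_zero_field :
    gradNormSq (0 : UnitAddTorus (Fin 3) → EuclideanSpace ℝ (Fin 3)) = 0 := by
  unfold gradNormSq
  simp [Torus.partialDeriv, Torus.lineDeriv]

/-- **Step 5 (Proposal 5 p. 7, as printed) holds**: for `ν > 0`, data of the class (38) and `T > 0`
there is `r ≥ 1` (any: take `r = 1`) such that every periodic smooth solution on `[0,T]` from `u₀` has
`‖u(t)‖_r²` bounded on `[0,T]` — because (38) forces `u₀ = 0` (`dataClass38_eq_zero`) and the only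
classical mean-zero solution from the zero datum is the rest state (uniqueness of strong solutions,
tree `Torus.IsClassicalNSSolutionOn.eq_zero_of_gradNormSq_eq_zero_of_le`), whose norms vanish.
TRUE BUT VACUOUS, as recorded in ADJUDICATED #40. [cite: LiJunDe2013NSPeriodic, Proposal 5 p. 7] -/
theorem step5_proposal5_holds : Step5_Proposal5 := by
  intro ν hν u₀ K₃ h38 T hT
  refine ⟨1, le_rfl, fun u p hsol => ⟨0, fun t ht => ?_⟩⟩
  obtain ⟨hcl, hu0, hdat, -⟩ := hsol
  have hz : u₀ = 0 := dataClass38_eq_zero h38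
  have h0 : gradNormSq (u 0) = 0 := by rw [hu0, hz]; exact gradNormSq_zero_field
  have hut : u t = 0 :=
    hcl.eq_zero_of_gradNormSq_eq_zero_of_le hν.le (convex_Icc 0 T) (fun s hs => (hdat s hs).2.2)
      (s := 0) ⟨le_rfl, hT.le⟩ h0 ht ht.1
  rw [hut, show (0 : UnitAddTorus (Fin 3) → EuclideanSpace ℝ (Fin 3)) =
      fun _ => (0 : EuclideanSpace ℝ (Fin 3)) from rfl, normSq_zero_fun]
  simp

end Summit.NavierStokesRegularity.NavierStokesRegularity.Theorems.Li2013bSalvage
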